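import Mathlib
import HarnessLib
import Summits.ResolutionOfSingularities.ResolutionOfSingularities.Theorems.HomologicalConductorPersistenceStableAnnihilatorMatrix

/-!
# Crux `Persistence` (stmt-ResolutionOfSingularities-16484), chain W4.4b — U7 (part 2/2): the
# STABLE ANNIHILATOR of a MATRIX-FACTORISATION module

Route `ResolutionOfSingularities/HomologicalConductor`.  OURS (cell res-hironaka, crux chain W4.4b,
CRUX-PLAN w44b v11.1/v11.1a §H2L / §U7, signature cut `L/w44b/Sketch-U7.lean` of the planner
res-L1-w44b-plan-1; seat res-D-pv-058); nothing here is a statement of the manuscript under review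
(Hironaka 2017); AI-written, weaker than expert review.

Setting.  `S` a commutative ring, `f ∈ S`, `T := S ⧸ (f)`, `(φ, ψ)` a square MATRIX FACTORISATION of
`f` over `S` (`φ ψ = f • 1`, whence `ψ φ = f • 1` when `f` is a non-zero-divisor:
`mul_eq_smul_one_comm`), `φ̄ := φ mod f`, and the MF-module `M_φ := coker (φ̄ : Tⁿ → Tⁿ)` (the
`T`-module `(n → T) ⧸ range φ̄.mulVecLin`).  THE ONE CRITERION of §H2L (v11.1a: elementary in both
directions, no exactness input), on top of part 1's `stablyAnnihilates_coker_iff_exists_matrix`: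

  **`x̄` stably annihilates `M_φ`  iff  `x • 1 = G ψ + φ E` for some matrices `G`, `E` over `S`**
  (equivalently `x • 1 ∈ Mat·ψ + φ·Mat + f·Mat`, the `f`-summand being `φ (ψ H)`).

* U7a `stablyAnnihilates_coker_of_eq` (⇐): `ψ φ = f • 1`, `x • 1 = G ψ + φ E + f • H ⇒ x̄ ∈ s̲ann(M_φ)`
  (`C̄ := Ḡ ψ̄` kills `φ̄`).
* U7b `stablyAnnihilates_coker_derivation` (KEPT FOR FREE): for every derivation `D` of `S`,
  Leibniz on `φ ψ = f • 1` gives `D f • 1 = (Dφ) ψ + φ (Dψ)`, so `D f` stably annihilates `M_φ`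
  (the Eisenbud-operator null-homotopy); consumers take `D := MvPolynomial.pderiv i`.
* U7d `not_exists_eq_of_entries_mem` (crude NON-MEMBERSHIP certificate): if all entries of `φ`, `ψ`
  lie in an ideal `J ∌ x`, then `x • 1 ∉ Mat·ψ + φ·Mat` (and `∉ Mat·ψ + φ·Mat + f·Mat` if `f ∈ J`).
* U7c `exists_eq_of_stablyAnnihilates_coker` (⇒): for `f` a non-zero-divisor and `φ ψ = f • 1`:
  `x̄ ∈ s̲ann(M_φ) ⇒ x • 1 = G ψ + φ E` (part 1: `C̄ φ̄ = 0`, `x̄ • 1 = C̄ + φ̄ Ē`; lift to `S`: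
  `C φ = f • C'`, so `f • C = C φ ψ = f • (C' ψ)` and `C = C' ψ`; the `f`-error is `φ (ψ H)`);
  with U7a the iff `stablyAnnihilates_coker_iff_exists_eq`.

References: D. Eisenbud, *Homological algebra on a complete intersection, with an application to
group representations*, Trans. AMS 260 (1980) 35–64 (matrix factorisations); S. B. Iyengar,
R. Takahashi, arXiv:1404.1476, Remark 2.13 [`IyengarTakahashi2014`].  All statements below are
folklore linear algebra over commutative rings.
-/

noncomputable section

-- single-problem summit: the doubled namespace component `ResolutionOfSingularities` is forced
set_option linter.dupNamespace false

open CategoryTheory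
open Summit.ResolutionOfSingularities.ResolutionOfSingularities.Theorems.NoZeno.SandwichCluster
open Summit.ResolutionOfSingularities.ResolutionOfSingularities.Theorems.HomologicalConductor.PersistenceStableAnnihilatorMatrix

universe u

namespace Summit.ResolutionOfSingularities.ResolutionOfSingularities.Theorems.HomologicalConductor.PersistenceStableAnnihilatorMF

/-! ## The matrix-factorisation module `M_φ = coker φ̄` over `T = S ⧸ (f)` -/

section MF

variable {S : Type u} [CommRing S] {n : Type}

/-- Reduction mod `I` of `x • 1` is `x̄ • 1`. [folklore] -/
theorem map_mk_smul_one [DecidableEq n] (I : Ideal S) (x : S) :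
    (x • (1 : Matrix n n S)).map (Ideal.Quotient.mk I) =
      Ideal.Quotient.mk I x • (1 : Matrix n n (S ⧸ I)) := by
  rw [Matrix.map_smul' _ _ _ (map_mul _), Matrix.map_one _ (map_zero _) (map_one _)]

/-- Reduction mod `f` of `f • H` vanishes. [folklore] -/
theorem map_mk_smul_self (f : S) (H : Matrix n n S) :
    (f • H).map (Ideal.Quotient.mk (Ideal.span {f})) = 0 := by
  rw [Matrix.map_smul' _ _ _ (map_mul _),
    Ideal.Quotient.eq_zero_iff_mem.mpr (Ideal.mem_span_singleton_self f), zero_smul]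

/-- Reduction mod `f` of `ψ φ = f • 1`: `ψ̄ φ̄ = 0`. [folklore] -/
theorem map_mul_map_eq_zero [Fintype n] [DecidableEq n] (f : S) (φ ψ : Matrix n n S)
    (hψφ : ψ * φ = f • (1 : Matrix n n S)) :
    ψ.map (Ideal.Quotient.mk (Ideal.span {f})) * φ.map (Ideal.Quotient.mk (Ideal.span {f})) = 0 := by
  rw [← Matrix.map_mul, hψφ, map_mk_smul_self]

/-- Entrywise lift of a matrix along the quotient map `S → S ⧸ I`. [folklore] -/
theorem exists_map_mk_eq (I : Ideal S) (M : Matrix n n (S ⧸ I)) :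
    ∃ N : Matrix n n S, N.map (Ideal.Quotient.mk I) = M := by
  refine ⟨M.map (fun a => (Ideal.Quotient.mk_surjective a).choose), ?_⟩
  ext i j
  simp only [Matrix.map_apply]
  exact (Ideal.Quotient.mk_surjective (M i j)).choose_spec

/-- A matrix over `S` that dies mod `f` is `f • H` for some matrix `H`. [folklore] -/
theorem exists_eq_smul_of_map_mk_eq_zero (f : S) (M : Matrix n n S)
    (h : M.map (Ideal.Quotient.mk (Ideal.span {f})) = 0) : ∃ H : Matrix n n S, M = f • H := by
  have hM : ∀ i j, ∃ a : S, a * f = M i j := fun i j => by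
    have hij := congrArg (fun N : Matrix n n (S ⧸ Ideal.span {f}) => N i j) h
    simp only [Matrix.map_apply, Matrix.zero_apply, Ideal.Quotient.eq_zero_iff_mem,
      Ideal.mem_span_singleton'] at hij
    exact hij
  refine ⟨Matrix.of fun i j => (hM i j).choose, ?_⟩
  ext i j
  rw [Matrix.smul_apply, Matrix.of_apply, smul_eq_mul, mul_comm, (hM i j).choose_spec]

/-- Cancelling a non-zero-divisor scalar from a matrix identity. [folklore] -/
theorem smul_cancel_of_mem_nonZeroDivisors (f : S) (hf : f ∈ nonZeroDivisors S)
    {M N : Matrix n n S} (h : f • M = f • N) : M = N := by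
  ext i j
  have hij := congrArg (fun P : Matrix n n S => P i j) h
  simp only [Matrix.smul_apply, smul_eq_mul] at hij
  have h0 : f * (M i j - N i j) = 0 := by rw [mul_sub, hij, sub_self]
  exact sub_eq_zero.mp ((mem_nonZeroDivisors_iff_left.mp hf) _ h0)

/-- **One-sided matrix factorisations of a non-zero-divisor are two-sided**: if `f` is a
non-zero-divisor of `S` and `φ ψ = f • 1` for square matrices `φ`, `ψ`, then `ψ φ = f • 1`
(`det φ · det ψ = f ^ n` is a non-zero-divisor, so `det φ` is; and
`det φ • (ψ φ) = adj(φ) (φ ψ) φ = det φ • (f • 1)`). [folklore] -/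
theorem mul_eq_smul_one_comm [Fintype n] [DecidableEq n] (f : S) (hf : f ∈ nonZeroDivisors S)
    (φ ψ : Matrix n n S) (hφψ : φ * ψ = f • (1 : Matrix n n S)) :
    ψ * φ = f • (1 : Matrix n n S) := by
  have hdet : φ.det * ψ.det = f ^ Fintype.card n := by
    rw [← Matrix.det_mul, hφψ, Matrix.det_smul, Matrix.det_one, mul_one]
  have hφdet : φ.det ∈ nonZeroDivisors S :=
    (mul_mem_nonZeroDivisors.mp (hdet ▸ pow_mem hf (Fintype.card n))).1
  refine smul_cancel_of_mem_nonZeroDivisors φ.det hφdet ?_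
  calc φ.det • (ψ * φ) = φ.adjugate * φ * (ψ * φ) := by
        rw [Matrix.adjugate_mul, Matrix.smul_mul, Matrix.one_mul]
    _ = φ.adjugate * (φ * ψ) * φ := by simp only [Matrix.mul_assoc]
    _ = f • (φ.adjugate * φ) := by rw [hφψ, Matrix.mul_smul, Matrix.mul_one, Matrix.smul_mul]
    _ = φ.det • (f • (1 : Matrix n n S)) := by rw [Matrix.adjugate_mul, smul_comm]

/-- **U7a (⇐).**  For `ψ φ = f • 1` over `S` and `x • 1 = G ψ + φ E + f • H`, the class `x̄` stably
annihilates the MF-module `M_φ = coker (φ̄ : Tⁿ → Tⁿ)` over `T = S ⧸ (f)` (`C̄ := Ḡ ψ̄` kills `φ̄`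
since `ψ̄ φ̄ = f̄ • 1 = 0`, and `x̄ • 1 = C̄ + φ̄ Ē`; i.e. `i := Ḡ ψ̄` descends to `M_φ`, `r :=` the
projection, `r ∘ i = x̄ • 1`).  The summand `f • H` dies mod `f` (and equals `φ (ψ H)` when also
`φ ψ = f • 1`); it is kept because it is the consumers' currency «`x • 1 ∈ Mat·ψ + φ·Mat + f·Mat`».
For a matrix factorisation of a non-zero-divisor, `ψ φ = f • 1` follows from `φ ψ = f • 1`
(`mul_eq_smul_one_comm`). [folklore; cite: IyengarTakahashi2014, Remark 2.13] -/
theorem stablyAnnihilates_coker_of_eq [Fintype n] [DecidableEq n] (f : S) (φ ψ G E H : Matrix n n S)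
    (hψφ : ψ * φ = f • (1 : Matrix n n S)) (x : S)
    (hx : x • (1 : Matrix n n S) = G * ψ + φ * E + f • H) :
    StablyAnnihilates (S ⧸ Ideal.span {f}) (Ideal.Quotient.mk (Ideal.span {f}) x)
      (ModuleCat.of (S ⧸ Ideal.span {f}) ((n → S ⧸ Ideal.span {f}) ⧸
        LinearMap.range (φ.map (Ideal.Quotient.mk (Ideal.span {f}))).mulVecLin)) := by
  refine stablyAnnihilates_coker_of_mul_eq_zero _ _ (G.map (Ideal.Quotient.mk (Ideal.span {f})))
    (E.map (Ideal.Quotient.mk (Ideal.span {f}))) (map_mul_map_eq_zero f φ ψ hψφ) _ ?_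
  have h := congrArg (RingHom.mapMatrix (m := n) (Ideal.Quotient.mk (Ideal.span {f}))) hx
  simp only [map_add, map_mul, RingHom.mapMatrix_apply, map_mk_smul_one, map_mk_smul_self,
    add_zero] at h
  exact h

/-- Entrywise image of a product of matrices under a derivation (Leibniz). [folklore] -/
theorem map_derivation_mul [Fintype n] {R : Type*} [CommRing R] [Algebra R S]
    (D : Derivation R S S) (φ ψ : Matrix n n S) :
    (φ * ψ).map D = φ.map D * ψ + φ * ψ.map D := by
  ext i j
  simp only [Matrix.map_apply, Matrix.mul_apply, Matrix.add_apply, map_sum, Derivation.leibniz,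
    smul_eq_mul, ← Finset.sum_add_distrib]
  exact Finset.sum_congr rfl fun k _ => by ring

/-- A derivation applied entrywise to `f • 1` gives `D f • 1`. [folklore] -/
theorem map_derivation_smul_one [DecidableEq n] {R : Type*} [CommRing R] [Algebra R S]
    (D : Derivation R S S) (f : S) :
    (f • (1 : Matrix n n S)).map D = D f • (1 : Matrix n n S) := by
  ext i j
  by_cases hij : i = j
  · subst hij; simp
  · simp [hij]

/-- **Leibniz for a matrix factorisation** (the Eisenbud-operator identity): `φ ψ = f • 1` implies
`D f • 1 = (Dφ) ψ + φ (Dψ)` for every derivation `D` of `S`, applied entrywise. [folklore] -/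
theorem derivation_smul_one_eq [Fintype n] [DecidableEq n] {R : Type*} [CommRing R] [Algebra R S]
    (D : Derivation R S S) (f : S) (φ ψ : Matrix n n S) (hφψ : φ * ψ = f • (1 : Matrix n n S)) :
    D f • (1 : Matrix n n S) = φ.map D * ψ + φ * ψ.map D := by
  rw [← map_derivation_smul_one D f, ← hφψ, map_derivation_mul]

/-- **U7b (KEPT FOR FREE on MF-modules).**  For a matrix factorisation `φ ψ = ψ φ = f • 1` over
`S` and ANY derivation `D` of `S` (over any base ring `R`; `R = ℤ` for a bare derivation), the class
of `D f` stably annihilates `M_φ = coker φ̄` over `T = S ⧸ (f)`: Leibniz gives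
`D f • 1 = (Dφ) ψ + φ (Dψ)`, an instance of U7a with `G := Dφ`, `E := Dψ`, `H := 0`.  Consumers take
`S = MvPolynomial σ k` and `D := MvPolynomial.pderiv i`, so every partial `∂f/∂xᵢ` stably
annihilates every MF-module of `f`; `ψ φ = f • 1` is automatic for `f` a non-zero-divisor
(`stablyAnnihilates_coker_derivation'`). [folklore] -/
theorem stablyAnnihilates_coker_derivation [Fintype n] [DecidableEq n] {R : Type*} [CommRing R]
    [Algebra R S] (D : Derivation R S S) (f : S) (φ ψ : Matrix n n S)
    (hφψ : φ * ψ = f • (1 : Matrix n n S)) (hψφ : ψ * φ = f • (1 : Matrix n n S)) :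
    StablyAnnihilates (S ⧸ Ideal.span {f}) (Ideal.Quotient.mk (Ideal.span {f}) (D f))
      (ModuleCat.of (S ⧸ Ideal.span {f}) ((n → S ⧸ Ideal.span {f}) ⧸
        LinearMap.range (φ.map (Ideal.Quotient.mk (Ideal.span {f}))).mulVecLin)) :=
  stablyAnnihilates_coker_of_eq f φ ψ (φ.map D) (ψ.map D) 0 hψφ (D f)
    (by rw [smul_zero, add_zero]; exact derivation_smul_one_eq D f φ ψ hφψ)

/-- U7b for a matrix factorisation `φ ψ = f • 1` of a NON-ZERO-DIVISOR `f` (then `ψ φ = f • 1` is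
automatic): `D f` stably annihilates `coker φ̄` for every derivation `D`. [folklore] -/
theorem stablyAnnihilates_coker_derivation' [Fintype n] [DecidableEq n] {R : Type*} [CommRing R]
    [Algebra R S] (D : Derivation R S S) (f : S) (hf : f ∈ nonZeroDivisors S) (φ ψ : Matrix n n S)
    (hφψ : φ * ψ = f • (1 : Matrix n n S)) :
    StablyAnnihilates (S ⧸ Ideal.span {f}) (Ideal.Quotient.mk (Ideal.span {f}) (D f))
      (ModuleCat.of (S ⧸ Ideal.span {f}) ((n → S ⧸ Ideal.span {f}) ⧸
        LinearMap.range (φ.map (Ideal.Quotient.mk (Ideal.span {f}))).mulVecLin)) :=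
  stablyAnnihilates_coker_derivation D f φ ψ hφψ (mul_eq_smul_one_comm f hf φ ψ hφψ)

/-- **U7d (crude non-membership certificate).**  If every entry of `φ` and of `ψ` lies in an ideal
`J` and `x ∉ J` (and the index type is nonempty), then `x • 1 ∉ Mat·ψ + φ·Mat`: the diagonal
entries of `G ψ + φ E` lie in `J`. [folklore] -/
theorem not_exists_eq_of_entries_mem [Fintype n] [DecidableEq n] [Nonempty n] (J : Ideal S) (x : S)
    (φ ψ : Matrix n n S) (hφ : ∀ i j, φ i j ∈ J) (hψ : ∀ i j, ψ i j ∈ J) (hx : x ∉ J) :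
    ¬ ∃ G E : Matrix n n S, x • (1 : Matrix n n S) = G * ψ + φ * E := by
  rintro ⟨G, E, h⟩
  obtain ⟨i⟩ := ‹Nonempty n›
  have hi := congrArg (fun M : Matrix n n S => M i i) h
  simp only [Matrix.smul_apply, Matrix.one_apply_eq, smul_eq_mul, mul_one, Matrix.add_apply,
    Matrix.mul_apply] at hi
  apply hx
  rw [hi]
  exact J.add_mem (J.sum_mem fun k _ => J.mul_mem_left _ (hψ k i))
    (J.sum_mem fun k _ => J.mul_mem_right _ (hφ i k))

/-- U7d in the three-summand currency: if moreover `f ∈ J`, then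
`x • 1 ∉ Mat·ψ + φ·Mat + f·Mat`. [folklore] -/
theorem not_exists_eq_add_smul_of_entries_mem [Fintype n] [DecidableEq n] [Nonempty n] (J : Ideal S)
    (f x : S) (φ ψ : Matrix n n S) (hφ : ∀ i j, φ i j ∈ J) (hψ : ∀ i j, ψ i j ∈ J) (hf : f ∈ J)
    (hx : x ∉ J) :
    ¬ ∃ G E H : Matrix n n S, x • (1 : Matrix n n S) = G * ψ + φ * E + f • H := by
  rintro ⟨G, E, H, h⟩
  obtain ⟨i⟩ := ‹Nonempty n›
  have hi := congrArg (fun M : Matrix n n S => M i i) h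
  simp only [Matrix.smul_apply, Matrix.one_apply_eq, smul_eq_mul, mul_one, Matrix.add_apply,
    Matrix.mul_apply] at hi
  apply hx
  rw [hi]
  exact J.add_mem (J.add_mem (J.sum_mem fun k _ => J.mul_mem_left _ (hψ k i))
    (J.sum_mem fun k _ => J.mul_mem_right _ (hφ i k))) (J.mul_mem_right _ hf)

/-- **U7c (⇒).**  For `f` a non-zero-divisor of `S` and `φ ψ = f • 1`: if `x̄` stably annihilates
`M_φ = coker φ̄` over `T = S ⧸ (f)`, then `x • 1 = G ψ + φ E` for some matrices `G`, `E` over `S`.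
(Core criterion: `C̄ φ̄ = 0` and `x̄ • 1 = C̄ + φ̄ Ē`; lift `C`, `E` to `S`: `C φ = f • C'` and
`x • 1 = C + φ E + f • H`; then `f • C = C (φ ψ) = f • (C' ψ)`, so `C = C' ψ` since `f` is a
non-zero-divisor, and `f • H = φ (ψ H)`: `x • 1 = C' ψ + φ (E + ψ H)`.)  No exactness input is
needed (CRUX-PLAN v11.1a). [folklore] -/
theorem exists_eq_of_stablyAnnihilates_coker [Fintype n] [DecidableEq n] (f : S)
    (hf : f ∈ nonZeroDivisors S) (φ ψ : Matrix n n S) (hφψ : φ * ψ = f • (1 : Matrix n n S)) (x : S)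
    (h : StablyAnnihilates (S ⧸ Ideal.span {f}) (Ideal.Quotient.mk (Ideal.span {f}) x)
      (ModuleCat.of (S ⧸ Ideal.span {f}) ((n → S ⧸ Ideal.span {f}) ⧸
        LinearMap.range (φ.map (Ideal.Quotient.mk (Ideal.span {f}))).mulVecLin))) :
    ∃ G E : Matrix n n S, x • (1 : Matrix n n S) = G * ψ + φ * E := by
  obtain ⟨C', E', hCφ, hxCE⟩ := (stablyAnnihilates_coker_iff_exists_matrix _ _).mp h
  obtain ⟨C, rfl⟩ := exists_map_mk_eq (Ideal.span {f}) C'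
  obtain ⟨E, rfl⟩ := exists_map_mk_eq (Ideal.span {f}) E'
  -- `C φ` dies mod `f`
  have hCφ0 : (C * φ).map (Ideal.Quotient.mk (Ideal.span {f})) = 0 := by
    rw [Matrix.map_mul, hCφ]
  obtain ⟨C₁, hC₁⟩ := exists_eq_smul_of_map_mk_eq_zero f _ hCφ0
  -- the defect `x • 1 - (C + φ E)` dies mod `f`
  have hdef : (x • (1 : Matrix n n S) - (C + φ * E)).map (Ideal.Quotient.mk (Ideal.span {f}))
      = 0 := by
    have e : (x • (1 : Matrix n n S) - (C + φ * E)).map (Ideal.Quotient.mk (Ideal.span {f})) =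
        RingHom.mapMatrix (Ideal.Quotient.mk (Ideal.span {f}))
          (x • (1 : Matrix n n S) - (C + φ * E)) :=
      rfl
    rw [e, map_sub, map_add, map_mul]
    simp only [RingHom.mapMatrix_apply, map_mk_smul_one]
    rw [hxCE, sub_self]
  obtain ⟨H, hH⟩ := exists_eq_smul_of_map_mk_eq_zero f _ hdef
  have e1 : x • (1 : Matrix n n S) = C + φ * E + f • H := by rw [← hH]; abel
  -- `C = C₁ ψ`: `f • C = C (φ ψ) = (C φ) ψ = f • (C₁ ψ)`
  have hC : C = C₁ * ψ := by
    refine smul_cancel_of_mem_nonZeroDivisors f hf ?_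
    rw [← Matrix.mul_one C, ← Matrix.mul_smul, ← hφψ, ← Matrix.mul_assoc, hC₁, Matrix.smul_mul]
  -- `f • H = φ (ψ H)`
  have hfH : f • H = φ * (ψ * H) := by
    rw [← Matrix.mul_assoc, hφψ, Matrix.smul_mul, Matrix.one_mul]
  refine ⟨C₁, E + ψ * H, ?_⟩
  rw [e1, hC, hfH, Matrix.mul_add, add_assoc]

/-- **THE CRITERION (U7a + U7c).**  For a matrix factorisation `φ ψ = f • 1` of a non-zero-divisor
`f` over `S` and `x ∈ S`: `x̄` stably annihilates `M_φ = coker φ̄` over `T = S ⧸ (f)` iff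
`x • 1 = G ψ + φ E` for some matrices `G`, `E` over `S`. [folklore] -/
theorem stablyAnnihilates_coker_iff_exists_eq [Fintype n] [DecidableEq n] (f : S)
    (hf : f ∈ nonZeroDivisors S) (φ ψ : Matrix n n S) (hφψ : φ * ψ = f • (1 : Matrix n n S))
    (x : S) :
    StablyAnnihilates (S ⧸ Ideal.span {f}) (Ideal.Quotient.mk (Ideal.span {f}) x)
      (ModuleCat.of (S ⧸ Ideal.span {f}) ((n → S ⧸ Ideal.span {f}) ⧸
        LinearMap.range (φ.map (Ideal.Quotient.mk (Ideal.span {f}))).mulVecLin)) ↔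
      ∃ G E : Matrix n n S, x • (1 : Matrix n n S) = G * ψ + φ * E :=
  ⟨exists_eq_of_stablyAnnihilates_coker f hf φ ψ hφψ x, fun ⟨G, E, hGE⟩ =>
    stablyAnnihilates_coker_of_eq f φ ψ G E 0 (mul_eq_smul_one_comm f hf φ ψ hφψ) x
      (by rw [smul_zero, add_zero]; exact hGE)⟩

/-- The two membership currencies agree: `x • 1 ∈ Mat·ψ + φ·Mat + f·Mat` iff
`x • 1 ∈ Mat·ψ + φ·Mat`, as soon as `φ ψ = f • 1` (`f • H = φ (ψ H)`). [folklore] -/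
theorem exists_eq_add_add_smul_iff [Fintype n] [DecidableEq n] (f : S) (φ ψ : Matrix n n S)
    (hφψ : φ * ψ = f • (1 : Matrix n n S)) (x : S) :
    (∃ G E H : Matrix n n S, x • (1 : Matrix n n S) = G * ψ + φ * E + f • H) ↔
      ∃ G E : Matrix n n S, x • (1 : Matrix n n S) = G * ψ + φ * E := by
  constructor
  · rintro ⟨G, E, H, h⟩
    refine ⟨G, E + ψ * H, ?_⟩
    rw [h, Matrix.mul_add, ← Matrix.mul_assoc φ ψ H, hφψ, Matrix.smul_mul, Matrix.one_mul, add_assoc]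
  · rintro ⟨G, E, h⟩
    exact ⟨G, E, 0, by rw [smul_zero, add_zero]; exact h⟩

/-- The criterion in the three-summand currency of CRUX-PLAN §H2L: for a matrix factorisation
`φ ψ = f • 1` of a non-zero-divisor `f`, `x̄` stably annihilates `coker φ̄` iff
`x • 1 ∈ Mat·ψ + φ·Mat + f·Mat`. [folklore] -/
theorem stablyAnnihilates_coker_iff_exists_eq_add_add_smul [Fintype n] [DecidableEq n] (f : S)
    (hf : f ∈ nonZeroDivisors S) (φ ψ : Matrix n n S) (hφψ : φ * ψ = f • (1 : Matrix n n S))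
    (x : S) :
    StablyAnnihilates (S ⧸ Ideal.span {f}) (Ideal.Quotient.mk (Ideal.span {f}) x)
      (ModuleCat.of (S ⧸ Ideal.span {f}) ((n → S ⧸ Ideal.span {f}) ⧸
        LinearMap.range (φ.map (Ideal.Quotient.mk (Ideal.span {f}))).mulVecLin)) ↔
      ∃ G E H : Matrix n n S, x • (1 : Matrix n n S) = G * ψ + φ * E + f • H := by
  rw [stablyAnnihilates_coker_iff_exists_eq f hf φ ψ hφψ x, exists_eq_add_add_smul_iff f φ ψ hφψ x]

end MF

end Summit.ResolutionOfSingularities.ResolutionOfSingularities.Theorems.HomologicalConductor.PersistenceStableAnnihilatorMF
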